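import Summits.CriticalPhenomena.PercolationContinuityZ3.Theorems.PercNearOneGluingNoHeavyLowerTailSunflowerResZeroShift
import Summits.CriticalPhenomena.PercolationContinuityZ3.Theorems.PercNearOneGluingNoHeavyLowerTailSunflowerPendant
import HarnessLib

/-!
# `NoHeavyLowerTail` (crux stmt-CriticalPhenomena-4575), abstract sunflower cubic: THE RELATIVE LEMMA A FOR THE PENDANT PAIR
# `RLA(A ∪ [z₁u], A ∪ [z₁] ∪ [w])` — the set-level form of the two-linked-systems inequality (RES0′) ∀n

Support file (seat `prim-ineq-prove-1` gen 66; `--supports stmt-CriticalPhenomena-4575`).  No `sorry`, no named facts, no new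
definitions.  Memo: run/shared/lean/prim/prim-ineq-prove-1/FINDING-RLA-prove1-g66.md §2.

SETTING (`…SunflowerSafeCalculus`, `…SunflowerSafeMinors`, `…SunflowerPendant`).  `μ = prodBernoulli p` on `Set ι`; `Safe p A`
= Lemma A in product form (`∏ μ(V_i) ≤ μ(A)^(n−1)` for up-sets meeting pairwise inside `A`); minors `delMinor v = secOff v`,
`conMinor v = secOn v`; `pairOpen z₁ u = {z₁, u open}`.  A RELATIVE LEMMA A `RLA(C, T)` for cores `C ⊆ T` asks
`∏_{i<n} μ(L_i) ≤ μ(T)·μ(C)^(n−1)` for every `n ≥ 1` and every family of up-sets `L_i ⊆ T` meeting pairwise inside `C`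
(memo FINDING-COEFFWISE-prove1-g51.md §2, §5: RLA is Lemma A "inside the ambient event `T`"; it holds by conditioning when
`T` is a subcube, is false for `([uw], [u] ∪ [w])`, and `RLA(A ∪ [z₁u], A ∪ [w] ∪ [z₁])` is (RES0), the `z₂`-slice of the
leaf-leaf lemma).
* **`relLemmaA_pendant`** (fixed `p`).  Let `A` be an up-set not depending on `z₁`, `z₁, u, w` distinct, with
  `delMinor u A`, `conMinor w A`, `conMinor u (conMinor w A)` safe at `p` and `μ(delMinor u A) > 0`.  Then
  `RLA(A ∪ [z₁u], A ∪ [z₁u] ∪ [z₁] ∪ [w])` holds at `p`: for every `n ≥ 1` and up-sets `V_0,…,V_{n−1} ⊆ A ∪ [z₁u] ∪ [z₁] ∪ [w]`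
  with `V_i ∩ V_j ⊆ A ∪ [z₁u]` (`i ≠ j`), `∏ μ(V_i) ≤ μ(A ∪ [z₁u] ∪ [z₁] ∪ [w]) · μ(A ∪ [z₁u])^(n−1)`.
  PROOF.  Condition on `z₁`, then on `u` (branch `z₁` open) resp. `w` (branch `z₁` closed), then on the remaining one of
  `u, w` (`real_eq_secOn_secOff` three times).  For a petal `W ⊇ C := A ∪ [z₁u]` inside `T`: the `(z₁,u)`-open section is
  everything, the `z₁`-open `u`-closed sections `Ȳ_i` (values `(1−s)y_i + s k_i`) form a petal system of `delMinor u A`, the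
  `z₁`-closed `w`-open sections `H_i` (values `(1−σ)g_i + σh_i`) one of `conMinor w A`, their `u`-open parts `h_i` one of
  `conMinor u (conMinor w A)`, and the `z₁`-closed `w`-closed section is frozen at `delMinor w A` (it lies between the `C`- and
  the `T`-section, which coincide); links `g ≤ k`, `g ≤ h` are up-set monotonicity.  This is exactly the hypothesis list of
  `LinkedCurrency.res0_leafLeaf` (`…SunflowerResZeroShift`: (RES0′) ∀n with the leaf-leaf constant, from gen 65's `res0_all`),
  whose right-hand side is `μ(C)^(n−1)·μ(T)` on the nose.
* `relLemmaA_pendant_aSafe`: the same with the three safety hypotheses discharged from A-safety of `A` (`aSafe_delMinor`,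
  `aSafe_conMinor`).
The positivity hypothesis `μ(delMinor u A) > 0` (i.e. `b_Ȳ > 0`, some member of `A` avoids `u` with positive probability) is
what the capped pendant lemma divides by; the degenerate case is not treated here.  This is the first relative Lemma A beyond
subcubes in the tree; `…SunflowerLeafLeafZTwo` turns it into the `z₂`-petal case of the leaf-leaf lemma.
-/

noncomputable section

namespace Summit.CriticalPhenomena.PercolationContinuityZ3.Theorems.SunflowerPartition

namespace SafeCalc

open MeasureTheory Finset
open Literature.Probability.LatticeModels Literature.Probability.Percolation

variable {ι : Type*}

namespace RelLemmaA

open UnionEdge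

/-! ## One-coordinate sections: monotonicity, commutation, generators -/

/-- `secOn` is monotone in the event. [this work] -/
theorem secOn_mono (v : ι) {V W : Set (Set ι)} (h : V ⊆ W) : secOn v V ⊆ secOn v W := fun _ hω => h hω

/-- `secOff` is monotone in the event. [this work] -/
theorem secOff_mono (v : ι) {V W : Set (Set ι)} (h : V ⊆ W) : secOff v V ⊆ secOff v W := fun _ hω => h hω

/-- For an up-set the closed section lies inside the open one. [this work] -/
theorem secOff_subset_secOn (v : ι) {V : Set (Set ι)} (hV : IsUpperSet V) : secOff v V ⊆ secOn v V :=
  fun ω hω => hV (Set.sdiff_subset.trans (Set.subset_insert v ω)) hω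

/-- Sections at distinct coordinates commute (open/closed). [this work] -/
theorem secOn_secOff_comm {u v : ι} (huv : u ≠ v) (V : Set (Set ι)) : secOn u (secOff v V) = secOff v (secOn u V) := by
  ext ω
  simp only [secOn, secOff, Set.mem_setOf_eq]
  rw [Set.insert_sdiff_singleton_comm huv]

/-- Sections at two coordinates commute (open/open). [this work] -/
theorem secOn_secOn_comm (u v : ι) (V : Set (Set ι)) : secOn u (secOn v V) = secOn v (secOn u V) := by
  ext ω
  simp only [secOn, Set.mem_setOf_eq]
  rw [Set.insert_comm]

/-- Sections at two coordinates commute (closed/closed). [this work] -/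
theorem secOff_secOff_comm (u v : ι) (V : Set (Set ι)) : secOff u (secOff v V) = secOff v (secOff u V) := by
  ext ω
  simp only [secOff, Set.mem_setOf_eq]
  rw [Set.sdiff_sdiff_comm]

/-- `secOn` of an intersection. [this work] -/
theorem secOn_inter (v : ι) (V W : Set (Set ι)) : secOn v (V ∩ W) = secOn v V ∩ secOn v W := rfl

/-- `secOff` of an intersection. [this work] -/
theorem secOff_inter (v : ι) (V W : Set (Set ι)) : secOff v (V ∩ W) = secOff v V ∩ secOff v W := rfl

/-- `secOn` of a union. [this work] -/
theorem secOn_union (v : ι) (V W : Set (Set ι)) : secOn v (V ∪ W) = secOn v V ∪ secOn v W := rfl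

/-- `secOff` of a union. [this work] -/
theorem secOff_union (v : ι) (V W : Set (Set ι)) : secOff v (V ∪ W) = secOff v V ∪ secOff v W := rfl

/-- The open section of `{z, u open}` at `z` is `{u open}`. [this work] -/
theorem secOn_pairOpen_left {z u : ι} (hne : z ≠ u) : secOn z (pairOpen z u) = {ω | u ∈ ω} := by
  ext ω
  simp only [secOn, pairOpen, Set.mem_setOf_eq, Set.mem_insert_iff, true_or, true_and]
  exact ⟨fun h => h.resolve_left hne.symm, fun h => Or.inr h⟩

/-- The closed section of `{z, u open}` at `z` is empty. [this work] -/
theorem secOff_pairOpen_left (z u : ι) : secOff z (pairOpen z u) = ∅ := by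
  ext ω
  simp [secOff, pairOpen]

/-- The open section of `{u open}` at `u` is everything. [this work] -/
theorem secOn_setOf_mem_self (u : ι) : secOn u {ω : Set ι | u ∈ ω} = Set.univ := by
  ext ω; simp [secOn]

/-- The closed section of `{u open}` at `u` is empty. [this work] -/
theorem secOff_setOf_mem_self (u : ι) : secOff u {ω : Set ι | u ∈ ω} = ∅ := by
  ext ω; simp [secOff]

/-- The open section of `{u open}` at `v ≠ u` is `{u open}`. [this work] -/
theorem secOn_setOf_mem_of_ne {u v : ι} (h : u ≠ v) : secOn v {ω : Set ι | u ∈ ω} = {ω | u ∈ ω} := by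
  ext ω; simp [secOn, h]

/-- The closed section of `{u open}` at `v ≠ u` is `{u open}`. [this work] -/
theorem secOff_setOf_mem_of_ne {u v : ι} (h : u ≠ v) : secOff v {ω : Set ι | u ∈ ω} = {ω | u ∈ ω} := by
  ext ω; simp [secOff, h]

/-- An event not depending on `z` equals its open section at `z`. [this work] -/
theorem secOn_eq_self_of_determinedBy {A : Set (Set ι)} {z : ι} (hA : DeterminedBy A (↑({z} : Finset ι) : Set ι)ᶜ) :
    secOn z A = A := by
  ext ω
  simp only [secOn, Set.mem_setOf_eq]
  exact Pendant.mem_iff_of_determinedBy hA fun e he => by simp [he]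

/-- An event not depending on `z` equals its closed section at `z`. [this work] -/
theorem secOff_eq_self_of_determinedBy {A : Set (Set ι)} {z : ι} (hA : DeterminedBy A (↑({z} : Finset ι) : Set ι)ᶜ) :
    secOff z A = A := by
  ext ω
  simp only [secOff, Set.mem_setOf_eq]
  exact Pendant.mem_iff_of_determinedBy hA fun e he => by simp [he]

end RelLemmaA

/-! ## The relative Lemma A for the pendant pair -/

open RelLemmaA UnionEdge

variable [Fintype ι] [DecidableEq ι] (p : ι → unitInterval)

/-- **THE RELATIVE LEMMA A `RLA(A ∪ [z₁u], A ∪ [z₁u] ∪ [z₁] ∪ [w])` (fixed `p`).**  Let `A` be an up-set not depending on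
`z₁`, with `z₁, u, w` pairwise distinct; assume `delMinor u A`, `conMinor w A`, `conMinor u (conMinor w A)` are safe at `p`
and `μ(delMinor u A) > 0`.  Put `C = A ∪ {z₁,u open}` and `T = C ∪ {z₁ open} ∪ {w open}`.  Then for every `n ≥ 1` and
every family of up-sets `V_0, …, V_{n−1} ⊆ T` with `V_i ∩ V_j ⊆ C` (`i ≠ j`):
`∏_i μ(V_i) ≤ μ(T) · μ(C)^(n−1)`.  (The set-level (RES0) of memo FINDING-COEFFWISE-prove1-g51.md §5, via
`LinkedCurrency.res0_leafLeaf`.) [this work] -/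
theorem relLemmaA_pendant {z₁ u w : ι} (hzu : z₁ ≠ u) (hzw : z₁ ≠ w) (huw : u ≠ w) {A : Set (Set ι)}
    (hd : DeterminedBy A (↑({z₁} : Finset ι) : Set ι)ᶜ) (hA : IsUpperSet A)
    (hA0 : Safe p (delMinor u A)) (hA1 : Safe p (conMinor w A)) (hA11 : Safe p (conMinor u (conMinor w A)))
    (hpos : 0 < (prodBernoulli p).real (delMinor u A))
    {n : ℕ} (hn : 0 < n) (V : Fin n → Set (Set ι)) (hV : ∀ i, IsUpperSet (V i))
    (hcap : ∀ i j, i ≠ j → V i ∩ V j ⊆ A ∪ pairOpen z₁ u)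
    (hT : ∀ i, V i ⊆ A ∪ pairOpen z₁ u ∪ ({ω | z₁ ∈ ω} ∪ {ω | w ∈ ω})) :
    ∏ i, (prodBernoulli p).real (V i) ≤
      (prodBernoulli p).real (A ∪ pairOpen z₁ u ∪ ({ω | z₁ ∈ ω} ∪ {ω | w ∈ ω})) *
        (prodBernoulli p).real (A ∪ pairOpen z₁ u) ^ (n - 1) := by
  classical
  set C : Set (Set ι) := A ∪ pairOpen z₁ u with hC
  set T : Set (Set ι) := A ∪ pairOpen z₁ u ∪ ({ω | z₁ ∈ ω} ∪ {ω | w ∈ ω}) with hTdef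
  have hCT : C ⊆ T := Set.subset_union_left
  have hCup : IsUpperSet C := hA.union (isUpperSet_pairOpen z₁ u)
  have hz₁up : IsUpperSet {ω : Set ι | z₁ ∈ ω} := fun _ _ hle h => hle h
  have hwup : IsUpperSet {ω : Set ι | w ∈ ω} := fun _ _ hle h => hle h
  have hTup : IsUpperSet T := hCup.union (hz₁up.union hwup)
  -- enlarge the petals so that they contain the core
  set W : Fin n → Set (Set ι) := fun i => V i ∪ C with hW
  have hWup : ∀ i, IsUpperSet (W i) := fun i => (hV i).union hCup
  have hWC : ∀ i, C ⊆ W i := fun i => Set.subset_union_right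
  have hWT : ∀ i, W i ⊆ T := fun i => Set.union_subset (hT i) hCT
  have hWcap : ∀ i j, i ≠ j → W i ∩ W j ⊆ C := by
    intro i j hij ω hω
    rcases hω with ⟨h1 | h1, h2 | h2⟩
    · exact hcap i j hij ⟨h1, h2⟩
    exacts [h2, h1, h1]
  have hmono : ∀ i, (prodBernoulli p).real (V i) ≤ (prodBernoulli p).real (W i) :=
    fun i => measureReal_mono Set.subset_union_left
  -- coins
  set τ : ℝ := ((p z₁ : unitInterval) : ℝ) with hτ
  set σ : ℝ := ((p u : unitInterval) : ℝ) with hσ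
  set s : ℝ := ((p w : unitInterval) : ℝ) with hs
  have hτ0 : 0 ≤ τ := (p z₁).2.1
  have hτ1 : τ ≤ 1 := (p z₁).2.2
  have hσ0 : 0 ≤ σ := (p u).2.1
  have hσ1 : σ ≤ 1 := (p u).2.2
  have hs0 : 0 ≤ s := (p w).2.1
  have hs1 : s ≤ 1 := (p w).2.2
  -- sections of `A` and the floors
  have hA_on : secOn z₁ A = A := secOn_eq_self_of_determinedBy hd
  have hA_off : secOff z₁ A = A := secOff_eq_self_of_determinedBy hd
  set α00 : ℝ := (prodBernoulli p).real (secOff w (secOff u A)) with hα00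
  set α01 : ℝ := (prodBernoulli p).real (secOn w (secOff u A)) with hα01
  set α10 : ℝ := (prodBernoulli p).real (secOn u (secOff w A)) with hα10
  set α11 : ℝ := (prodBernoulli p).real (secOn u (secOn w A)) with hα11
  have hα0 : 0 ≤ α00 := measureReal_nonneg
  have h01 : α00 ≤ α01 := measureReal_mono (secOff_subset_secOn w (isUpperSet_secOff u hA))
  have h11 : α01 ≤ α11 := by
    rw [hα01, secOn_secOff_comm huw.symm]
    exact measureReal_mono (secOff_subset_secOn u (isUpperSet_secOn w hA))
  have h10 : α00 ≤ α10 := by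
    rw [hα00, secOff_secOff_comm w u]
    exact measureReal_mono (secOff_subset_secOn u (isUpperSet_secOff w hA))
  -- measures of the minors of `A`
  have hbY : (prodBernoulli p).real (delMinor u A) = (1 - s) * α00 + s * α01 := by
    rw [show delMinor u A = secOff u A from rfl, real_eq_secOn_secOff p w]; ring
  have hbH : (prodBernoulli p).real (conMinor w A) = (1 - σ) * α01 + σ * α11 := by
    rw [show conMinor w A = secOn w A from rfl, real_eq_secOn_secOff p u, ← secOn_secOff_comm huw.symm]; ring
  have hh11 : (prodBernoulli p).real (conMinor u (conMinor w A)) = α11 := rfl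
  have hũ : (prodBernoulli p).real (secOff w A) = (1 - σ) * α00 + σ * α10 := by
    rw [real_eq_secOn_secOff p u, ← secOff_secOff_comm w u]; ring
  have hb : 0 < (1 - s) * α00 + s * α01 := by rw [← hbY]; exact hpos
  -- sections of the cores
  have hC_on : secOn z₁ C = A ∪ {ω | u ∈ ω} := by rw [hC, secOn_union, hA_on, secOn_pairOpen_left hzu]
  have hC_off : secOff z₁ C = A := by rw [hC, secOff_union, hA_off, secOff_pairOpen_left, Set.union_empty]
  have hT_on : secOn z₁ T = Set.univ := by
    rw [hTdef, secOn_union, secOn_union, secOn_union, secOn_setOf_mem_self]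
    simp
  have hT_off : secOff z₁ T = A ∪ {ω | w ∈ ω} := by
    rw [hTdef, secOff_union, secOff_union, secOff_union, hA_off, secOff_pairOpen_left, secOff_setOf_mem_self,
      secOff_setOf_mem_of_ne hzw.symm, Set.union_empty, Set.empty_union]
  have hC_on_on : secOn u (secOn z₁ C) = Set.univ := by
    rw [hC_on, secOn_union, secOn_setOf_mem_self, Set.union_univ]
  have hC_on_off : secOff u (secOn z₁ C) = delMinor u A := by
    rw [hC_on, secOff_union, secOff_setOf_mem_self, Set.union_empty]; rfl
  have hToff_off : secOff w (secOff z₁ T) = secOff w A := by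
    rw [hT_off, secOff_union, secOff_setOf_mem_self, Set.union_empty]
  have hToff_on : secOn w (secOff z₁ T) = Set.univ := by
    rw [hT_off, secOn_union, secOn_setOf_mem_self, Set.union_univ]
  -- the measures of `C` and `T`
  have hCval : (prodBernoulli p).real C = τ * σ + (1 - τ) * (1 - s) * ((1 - σ) * α00 + σ * α10) +
      τ * (1 - σ) * ((1 - s) * α00 + s * α01) + s * (1 - τ) * ((1 - σ) * α01 + σ * α11) := by
    rw [real_eq_secOn_secOff p z₁ C, real_eq_secOn_secOff p u (secOn z₁ C), hC_on_on, hC_on_off, hbY, hC_off,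
      real_eq_secOn_secOff p w A, hũ, show secOn w A = conMinor w A from rfl, hbH, probReal_univ]
    ring
  have hTval : (prodBernoulli p).real T =
      τ * σ + (1 - τ) * (1 - s) * ((1 - σ) * α00 + σ * α10) + τ * (1 - σ) + s * (1 - τ) := by
    rw [real_eq_secOn_secOff p z₁ T, hT_on, real_eq_secOn_secOff p w (secOff z₁ T), hToff_on, hToff_off, hũ,
      probReal_univ]
    ring
  -- petal data
  set yv : Fin n → ℝ := fun i => (prodBernoulli p).real (secOff w (secOff u (secOn z₁ (W i)))) with hyv
  set kv : Fin n → ℝ := fun i => (prodBernoulli p).real (secOn w (secOff u (secOn z₁ (W i)))) with hkv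
  set gv : Fin n → ℝ := fun i => (prodBernoulli p).real (secOff u (secOn w (secOff z₁ (W i)))) with hgv
  set hv : Fin n → ℝ := fun i => (prodBernoulli p).real (secOn u (secOn w (secOff z₁ (W i)))) with hhv
  have hWon : ∀ i, secOn z₁ C ⊆ secOn z₁ (W i) := fun i => secOn_mono z₁ (hWC i)
  have hWoff : ∀ i, A ⊆ secOff z₁ (W i) := fun i => hC_off ▸ secOff_mono z₁ (hWC i)
  have hWoffT : ∀ i, secOff z₁ (W i) ⊆ A ∪ {ω | w ∈ ω} := fun i => hT_off ▸ secOff_mono z₁ (hWT i)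
  have hy : ∀ i ∈ (univ : Finset (Fin n)), α00 ≤ yv i := fun i _ =>
    measureReal_mono (secOff_mono w (secOff_mono u ((Set.subset_union_left).trans (hC_on ▸ hWon i))))
  have hy1 : ∀ i ∈ (univ : Finset (Fin n)), yv i ≤ 1 := fun i _ => measureReal_le_one
  have hk : ∀ i ∈ (univ : Finset (Fin n)), α01 ≤ kv i := fun i _ =>
    measureReal_mono (secOn_mono w (secOff_mono u ((Set.subset_union_left).trans (hC_on ▸ hWon i))))
  have hk1 : ∀ i ∈ (univ : Finset (Fin n)), kv i ≤ 1 := fun i _ => measureReal_le_one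
  have hg : ∀ i ∈ (univ : Finset (Fin n)), α01 ≤ gv i := fun i _ => by
    show (prodBernoulli p).real (secOn w (secOff u A)) ≤ _
    rw [secOn_secOff_comm huw.symm]
    exact measureReal_mono (secOff_mono u (secOn_mono w (hWoff i)))
  have hgk : ∀ i ∈ (univ : Finset (Fin n)), gv i ≤ kv i := fun i _ => by
    have h1 : secOff u (secOn w (secOff z₁ (W i))) ⊆ secOff u (secOn w (secOn z₁ (W i))) :=
      secOff_mono u (secOn_mono w (secOff_subset_secOn z₁ (hWup i)))
    rw [← secOn_secOff_comm huw.symm (secOn z₁ (W i))] at h1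
    exact measureReal_mono h1
  have hgh : ∀ i ∈ (univ : Finset (Fin n)), gv i ≤ hv i := fun i _ =>
    measureReal_mono (secOff_subset_secOn u (isUpperSet_secOn w (isUpperSet_secOff z₁ (hWup i))))
  have hh : ∀ i ∈ (univ : Finset (Fin n)), α11 ≤ hv i := fun i _ =>
    measureReal_mono (secOn_mono u (secOn_mono w (hWoff i)))
  have hh1 : ∀ i ∈ (univ : Finset (Fin n)), hv i ≤ 1 := fun i _ => measureReal_le_one
  -- budgets
  have hcardn : (univ : Finset (Fin n)).card = n := by simp
  have hBY : ∏ i ∈ (univ : Finset (Fin n)), ((1 - s) * yv i + s * kv i) ≤ ((1 - s) * α00 + s * α01) ^ ((univ : Finset (Fin n)).card - 1) := by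
    have hfam := hA0 n (fun i => secOff u (secOn z₁ (W i))) (fun i => isUpperSet_secOff u (isUpperSet_secOn z₁ (hWup i)))
      (fun i j hij => by
        rw [← secOff_inter, ← secOn_inter, ← hC_on_off]
        exact secOff_mono u (secOn_mono z₁ (hWcap i j hij)))
    rw [hbY] at hfam
    rw [hcardn]
    refine le_of_eq_of_le (prod_congr rfl fun i _ => ?_) hfam
    rw [real_eq_secOn_secOff p w (secOff u (secOn z₁ (W i)))]; ring
  have hBh : ∏ i ∈ (univ : Finset (Fin n)), hv i ≤ α11 ^ ((univ : Finset (Fin n)).card - 1) := by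
    have hfam := hA11 n (fun i => secOn u (secOn w (secOff z₁ (W i))))
      (fun i => isUpperSet_secOn u (isUpperSet_secOn w (isUpperSet_secOff z₁ (hWup i))))
      (fun i j hij => by
        rw [← secOn_inter, ← secOn_inter, ← secOff_inter, show conMinor u (conMinor w A) = secOn u (secOn w A) from rfl,
          ← hC_off]
        exact secOn_mono u (secOn_mono w (secOff_mono z₁ (hWcap i j hij))))
    rw [hcardn]; exact hfam
  have hBH : ∏ i ∈ (univ : Finset (Fin n)), ((1 - σ) * gv i + σ * hv i) ≤ ((1 - σ) * α01 + σ * α11) ^ ((univ : Finset (Fin n)).card - 1) := by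
    have hfam := hA1 n (fun i => secOn w (secOff z₁ (W i))) (fun i => isUpperSet_secOn w (isUpperSet_secOff z₁ (hWup i)))
      (fun i j hij => by
        rw [← secOn_inter, ← secOff_inter, show conMinor w A = secOn w A from rfl, ← hC_off]
        exact secOn_mono w (secOff_mono z₁ (hWcap i j hij)))
    rw [hbH] at hfam
    rw [hcardn]
    refine le_of_eq_of_le (prod_congr rfl fun i _ => ?_) hfam
    rw [real_eq_secOn_secOff p u (secOn w (secOff z₁ (W i)))]; ring
  -- petal values
  have hval : ∀ i, (prodBernoulli p).real (W i) ≤ τ * σ + (1 - τ) * (1 - s) * ((1 - σ) * α00 + σ * α10) +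
      τ * (1 - σ) * ((1 - s) * yv i + s * kv i) + s * (1 - τ) * ((1 - σ) * gv i + σ * hv i) := by
    intro i
    have e1 : (prodBernoulli p).real (secOn u (secOn z₁ (W i))) = 1 :=
      le_antisymm measureReal_le_one (by
        rw [← probReal_univ (μ := prodBernoulli p), ← hC_on_on]
        exact measureReal_mono (secOn_mono u (hWon i)))
    have e2 : (prodBernoulli p).real (secOff w (secOff z₁ (W i))) = (1 - σ) * α00 + σ * α10 := by
      rw [← hũ]
      refine le_antisymm (measureReal_mono ?_) (measureReal_mono (secOff_mono w (hWoff i)))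
      calc secOff w (secOff z₁ (W i)) ⊆ secOff w (A ∪ {ω | w ∈ ω}) := secOff_mono w (hWoffT i)
        _ = secOff w A := by rw [secOff_union, secOff_setOf_mem_self, Set.union_empty]
    have e3 : (prodBernoulli p).real (secOff u (secOn z₁ (W i))) = (1 - s) * yv i + s * kv i := by
      rw [real_eq_secOn_secOff p w (secOff u (secOn z₁ (W i)))]; ring
    have e4 : (prodBernoulli p).real (secOn w (secOff z₁ (W i))) = (1 - σ) * gv i + σ * hv i := by
      rw [real_eq_secOn_secOff p u (secOn w (secOff z₁ (W i)))]; ring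
    rw [real_eq_secOn_secOff p z₁ (W i), real_eq_secOn_secOff p u (secOn z₁ (W i)),
      real_eq_secOn_secOff p w (secOff z₁ (W i)), e1, e2, e3, e4]
    apply le_of_eq; ring
  -- the analytic inequality
  have hne : (univ : Finset (Fin n)).Nonempty := ⟨⟨0, hn⟩, mem_univ _⟩
  have key := LinkedCurrency.res0_leafLeaf hτ0 hτ1 hσ0 hσ1 hs0 hs1 hα0 hb h01 h11 h10 univ hne yv kv gv hv
    hy hy1 hk hk1 hg hgk hgh hh hh1 hBY hBh hBH
  rw [hcardn, ← hCval, ← hTval] at key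
  calc ∏ i, (prodBernoulli p).real (V i) ≤ ∏ i, (prodBernoulli p).real (W i) :=
        prod_le_prod (fun i _ => measureReal_nonneg) fun i _ => hmono i
    _ ≤ ∏ i, (τ * σ + (1 - τ) * (1 - s) * ((1 - σ) * α00 + σ * α10) +
          τ * (1 - σ) * ((1 - s) * yv i + s * kv i) + s * (1 - τ) * ((1 - σ) * gv i + σ * hv i)) :=
        prod_le_prod (fun i _ => measureReal_nonneg) fun i _ => hval i
    _ ≤ (prodBernoulli p).real C ^ (n - 1) * (prodBernoulli p).real T := key
    _ = (prodBernoulli p).real T * (prodBernoulli p).real C ^ (n - 1) := mul_comm _ _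

/-- **`RLA(A ∪ [z₁u], A ∪ [z₁u] ∪ [z₁] ∪ [w])` from A-safety of `A`** (the three minors of an A-safe core are safe at every
`p`: `aSafe_delMinor`, `aSafe_conMinor`), under the positivity `μ_p(delMinor u A) > 0`. [this work] -/
theorem relLemmaA_pendant_aSafe {z₁ u w : ι} (hzu : z₁ ≠ u) (hzw : z₁ ≠ w) (huw : u ≠ w) {A : Set (Set ι)}
    (hd : DeterminedBy A (↑({z₁} : Finset ι) : Set ι)ᶜ) (hA : IsUpperSet A) (hsafe : ∀ q, Safe q A)
    (hpos : 0 < (prodBernoulli p).real (delMinor u A))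
    {n : ℕ} (hn : 0 < n) (V : Fin n → Set (Set ι)) (hV : ∀ i, IsUpperSet (V i))
    (hcap : ∀ i j, i ≠ j → V i ∩ V j ⊆ A ∪ pairOpen z₁ u)
    (hT : ∀ i, V i ⊆ A ∪ pairOpen z₁ u ∪ ({ω | z₁ ∈ ω} ∪ {ω | w ∈ ω})) :
    ∏ i, (prodBernoulli p).real (V i) ≤
      (prodBernoulli p).real (A ∪ pairOpen z₁ u ∪ ({ω | z₁ ∈ ω} ∪ {ω | w ∈ ω})) *
        (prodBernoulli p).real (A ∪ pairOpen z₁ u) ^ (n - 1) :=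
  relLemmaA_pendant p hzu hzw huw hd hA (aSafe_delMinor hA hsafe u p) (aSafe_conMinor hA hsafe w p)
    (aSafe_conMinor (isUpperSet_secOn w hA) (fun q => aSafe_conMinor hA hsafe w q) u p) hpos hn V hV hcap hT

end SafeCalc

end Summit.CriticalPhenomena.PercolationContinuityZ3.Theorems.SunflowerPartition
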